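/-
Copyright (c) 2026. All rights reserved.
Released under Apache 2.0 license as described in the file LICENSE.
-/
import Summits.HodgeConjecture.HodgeConjecture.Theorems.K2LiuArchKTypeRoutes            -- ★ asm FILE 7 p861934 (routes, whole type, uniqueness)
import Summits.HodgeConjecture.HodgeConjecture.Theorems.K2LiuLadderIntertwinerScalars   -- ★ (H1) `differentiableOn_finset_prod`
import Mathlib.Analysis.Complex.RemovableSingularity                                    -- `Complex.differentiableOn_dslope`
import Mathlib.Analysis.SpecialFunctions.Gamma.Beta                                     -- `Complex.one_div_Gamma_eq_self_mul_one_div_Gamma_add_one`, `differentiable_one_div_Gamma`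
import HarnessLib

/-!
# Crux `HLiu418`, G6-arch ASSEMBLY FILE 8 — (E8) per `K_w`-type at a complex place: THE SCALAR OF `M_w(s)` ON `W_{(k′,l′)} ⊂ I_w(s,χ_k)` IS A HOLOMORPHIC
# FUNCTION `G` ON `{0 < re s}` FOR ODD `k`, and at EVERY `s` with `re s > ½` EVERY section with compact picture `Q ∈ W_{(k′,l′)}` has `cp M_w(s) F = G(s) • Q`

Cell `hodgecm-mathlib`, crux item hLiu418 = `stmt-HodgeConjecture-24832` (helper lane `--supports`, count-neutral).  The arch block letter `hA` of ★
`K2LiuBigCellContinuationOfFaces.exists_bigCell_continuation_cm_of_faces` (K2Liu-p13 (g4)), per `K_w`-type, single complex place.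

Route `d` of ★ FILE 7 (`kType_pair_via`): `cp F = A_d(s) • f`, `cp M_w F = B_d(s) • f`, `f = f_{k′,l′}`, `m = d + l′`, `α = s+1−k∕2−m`, `β = s+1+k∕2+m`:
`A_d = ∏_{j<d}(α+j) · ∏_{j<k′−d}(β+j)`, `B_d = c_{k,m}(s) · A_d(−s-version)`, `c_{k,m} ∝ Γ₂(2s)4^{−2s} ∕ (Γ₂(α)Γ₂(β))`, `Γ₂(t) = πΓ(t)Γ(t−1)`.  REGULAR PART:
`(2s−1)Γ₂(2s) = πΓ(2s)²` (★ `two_mul_sub_one_mul_hermTwoGamma`) and `1∕Γ(α) = ∏_{j<d}(α+j) ∕ Γ(α+d)`, `1∕Γ(β) = ∏_{j<k′−d}(β+j) ∕ Γ(β+k′−d)` (Mathlib's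
`(Γ z)⁻¹ = z·(Γ(z+1))⁻¹`, valid at the poles too) give `(2s−1)·B_d(s) = R_d(s)·A_d(s)` with
`R_d(s) = (π⁴∕2)e^{iπ(k+2m)} · [πΓ(α+d)Γ(α−1)]⁻¹ · [πΓ(β+k′−d)Γ(β−1)]⁻¹ · πΓ(2s)²4^{−2s} · (the two polynomials of `B_d` at `−s`)` (written out in §2) — a product of
reciprocal Gammas (entire), `Γ(2s)²` (holomorphic on `re s > 0`), `4^{−2s}` and polynomials: HOLOMORPHIC ON `{0 < re}`.  For ODD `k`, at `s = ½` the integers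
`α−1 = −(n+d+l′)` and `β−1 = 1+n+d+l′` (`k = 2n+1`) cannot both be positive: `R_d(½) = 0`, so `G_d := ½·dslope R_d ½` is holomorphic on `{0<re}` with
`(2s−1)G_d = R_d` (Mathlib `Complex.differentiableOn_dslope`, `sub_smul_dslope`), hence `B_d = G_d·A_d` on `re s > ½`.  The routes are glued by the identity
theorem (they all compute THE scalar where live, and all routes are live off the real axis), and ★ FILE 7 (`exists_route_live`, `forall_mem_kType_pair`,
`kType_scalar_at`) turns this into the statement of the title.
* §1 `inv_Gamma_eq_prod_mul_inv_Gamma_add`; §2 `regular_identity`; §3 `differentiableOn_regularPart`; §4 `regularPart_half_eq_zero` (odd `k`);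
* §5 `continued_spec` (`(2s−1)·G_d(s) = R_d(s) − R_d(½)`), `differentiableOn_continued` (the half-plane is a neighbourhood of `½`, cf. ★ `K2LiuRankOneInnerWhittakerContinued.halfPlane_mem_nhds_half`); §6 `route_scalar` (live route ⇒ `cp M_w F = G_d(s) • f`), `A_ne_zero_of_im_ne_zero`,
  `route_eq` (two live routes agree), `route_glue` (`G_d = G_{d′}` on `{0<re}`);
* §7 **`kType_scalar_continuation (hk : Odd k) (k′ l′) : ∃ G, DifferentiableOn ℂ G {0<re} ∧ (∀ d ≤ k′, ∀ s, ½<re s → G s · A_d s = B_d s) ∧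
  ∀ s, ½ < re s → ∀ Q ∈ W_{(k′,l′)}, (∃ F ∈ I_w(s,χ_k), cp F = Q ∧ cp M_w F = G s • Q) ∧ (∀ F ∈ I_w(s,χ_k), cp F = Q → cp-values of M_w(s)F = G s • Q)`**.
References: [Shimura1982, (1.31)]; [LeeZhu1998, §5 Prop. 5.4]; [KudlaRallis1994, §1 (citation)]; [Tan1999, §3].
HONEST LABEL: HC_CM is proved only modulo the 7 printed citations (2 remaining named inputs: hLiu418 = stmt-HodgeConjecture-24832,
h413 = stmt-HodgeConjecture-24833) until rung 0 closes; count-neutral helper, closes no socket.  Even `k` (a genuine simple pole at `½`) is not faced here.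
-/

set_option autoImplicit false
set_option linter.dupNamespace false

noncomputable section

open Complex Matrix MeasureTheory NormedSpace Filter
open scoped ComplexConjugate ComplexOrder Topology

namespace Summit.HodgeConjecture.HodgeConjecture.Cruxes.HLiu418.K2LiuArchKTypeScalarContinuation

open Summit.HodgeConjecture.HodgeConjecture.Cruxes.HLiu418.K2LiuHermTwoGammaDefs (hermTwoGamma hermTwoGamma_def)
open Summit.HodgeConjecture.HodgeConjecture.Cruxes.HLiu418.K2LiuArchInducedTubeDefs
open Summit.HodgeConjecture.HodgeConjecture.Cruxes.HLiu418.K2LiuU22ShilovCoordinate (kU_mem_UJ)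
open Summit.HodgeConjecture.HodgeConjecture.Cruxes.HLiu418.K2LiuU22CompactPictureDefs
open Summit.HodgeConjecture.HodgeConjecture.Cruxes.HLiu418.K2LiuU22CompactPictureOperatorDictionary
open Summit.HodgeConjecture.HodgeConjecture.Cruxes.HLiu418.K2LiuArchSWOnePlaceRegion (evalAt_dz eq_of_apply_kU_eq det_ne_zero_of_unitary)
open Summit.HodgeConjecture.HodgeConjecture.Cruxes.HLiu418.K2LiuArchIntertwiningScalarPole (two_mul_sub_one_mul_hermTwoGamma ne_neg_nat_of_re_pos)
open Summit.HodgeConjecture.HodgeConjecture.Cruxes.HLiu418.K2LiuLadderIntertwinerScalars (differentiableOn_finset_prod)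
open Summit.HodgeConjecture.HodgeConjecture.Cruxes.HLiu418.K2LiuArchLadderPairTransport (scalar_of_pair)
open Summit.HodgeConjecture.HodgeConjecture.Cruxes.HLiu418.K2LiuArchKTypeRoutes (kType_pair_via exists_route_live forall_mem_kType_pair kType_scalar_at archIntertwining_congr_UJ)

/-! ## §1  The reciprocal Gamma recursion, iterated (valid at the poles) -/

/-- `(Γ z)⁻¹ = (∏_{j<n} (z+j)) · (Γ(z+n))⁻¹` for ALL `z` (Mathlib's pole-proof one-step form, iterated). [folklore] -/
theorem inv_Gamma_eq_prod_mul_inv_Gamma_add (z : ℂ) (n : ℕ) :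
    (Complex.Gamma z)⁻¹ = (∏ j ∈ Finset.range n, (z + j)) * (Complex.Gamma (z + n))⁻¹ := by
  induction n with
  | zero => rw [Finset.prod_range_zero, one_mul, Nat.cast_zero, add_zero]
  | succ n ih =>
    rw [ih, Complex.one_div_Gamma_eq_self_mul_one_div_Gamma_add_one (z + n), Finset.prod_range_succ]
    push_cast
    ring

/-! ## §2  The regular part of route `d` -/

/-- **`(2s − 1) · B_d(s) = R_d(s) · A_d(s)`** (`2s ≠ 1`), `R_d` the explicit regular part (reciprocal Gammas × `πΓ(2s)²4^{−2s}` × polynomials). [Shimura1982, (1.31)] -/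
theorem regular_identity (k : ℤ) (k' : ℕ) (l' : ℤ) (d : ℕ) {s : ℂ} (hs2 : 2 * s - 1 ≠ 0) :
    (2 * s - 1) * ((((1 / 8 : ℂ) * (((4 * Real.pi ^ 4 : ℝ) : ℂ) * cexp ((Real.pi * I) * (k + 2 * (((d : ℤ) + l' : ℤ) : ℂ))) * (hermTwoGamma (s + 1 - k / 2 - (((d : ℤ) + l' : ℤ) : ℂ)))⁻¹ *
            (hermTwoGamma (s + 1 + k / 2 + (((d : ℤ) + l' : ℤ) : ℂ)))⁻¹ * (hermTwoGamma (2 * s) * (4 : ℂ) ^ (-(2 * s))))) *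
          (∏ j ∈ Finset.range d, ((-s + 1 + (-(k : ℂ)) / 2) - (((d : ℤ) + l' - j : ℤ) : ℂ)))) *
          (∏ j ∈ Finset.range (k' - d), ((-s + 1 - (-(k : ℂ)) / 2) + ((d + j : ℕ) : ℂ) + l'))) =
      ((1 / 8 : ℂ) * (((4 * Real.pi ^ 4 : ℝ) : ℂ) * cexp ((Real.pi * I) * (k + 2 * (((d : ℤ) + l' : ℤ) : ℂ)))) *
          (((Real.pi : ℂ))⁻¹ * ((Complex.Gamma ((s + 1 - k / 2 - (((d : ℤ) + l' : ℤ) : ℂ)) + (d : ℂ)))⁻¹ * (Complex.Gamma ((s + 1 - k / 2 - (((d : ℤ) + l' : ℤ) : ℂ)) - 1))⁻¹)) *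
          (((Real.pi : ℂ))⁻¹ * ((Complex.Gamma ((s + 1 + k / 2 + (((d : ℤ) + l' : ℤ) : ℂ)) + ((k' - d : ℕ) : ℂ)))⁻¹ * (Complex.Gamma ((s + 1 + k / 2 + (((d : ℤ) + l' : ℤ) : ℂ)) - 1))⁻¹)) *
          ((Real.pi : ℂ) * Complex.Gamma (2 * s) ^ 2 * (4 : ℂ) ^ (-(2 * s))) *
          (∏ j ∈ Finset.range d, ((-s + 1 + (-(k : ℂ)) / 2) - (((d : ℤ) + l' - j : ℤ) : ℂ))) *
          (∏ j ∈ Finset.range (k' - d), ((-s + 1 - (-(k : ℂ)) / 2) + ((d + j : ℕ) : ℂ) + l'))) *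
        ((∏ j ∈ Finset.range d, ((s + 1 + (-(k : ℂ)) / 2) - (((d : ℤ) + l' - j : ℤ) : ℂ))) *
          (∏ j ∈ Finset.range (k' - d), ((s + 1 - (-(k : ℂ)) / 2) + ((d + j : ℕ) : ℂ) + l'))) := by
  have hα : (∏ j ∈ Finset.range d, ((s + 1 + (-(k : ℂ)) / 2) - (((d : ℤ) + l' - j : ℤ) : ℂ))) =
      ∏ j ∈ Finset.range d, ((s + 1 - k / 2 - (((d : ℤ) + l' : ℤ) : ℂ)) + j) := Finset.prod_congr rfl fun j _ => by push_cast; ring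
  have hβ : (∏ j ∈ Finset.range (k' - d), ((s + 1 - (-(k : ℂ)) / 2) + ((d + j : ℕ) : ℂ) + l')) =
      ∏ j ∈ Finset.range (k' - d), ((s + 1 + k / 2 + (((d : ℤ) + l' : ℤ) : ℂ)) + j) := Finset.prod_congr rfl fun j _ => by push_cast; ring
  rw [hα, hβ, hermTwoGamma_def (s + 1 - k / 2 - (((d : ℤ) + l' : ℤ) : ℂ)), hermTwoGamma_def (s + 1 + k / 2 + (((d : ℤ) + l' : ℤ) : ℂ)), mul_inv, mul_inv, mul_inv, mul_inv,
    inv_Gamma_eq_prod_mul_inv_Gamma_add (s + 1 - k / 2 - (((d : ℤ) + l' : ℤ) : ℂ)) d, inv_Gamma_eq_prod_mul_inv_Gamma_add (s + 1 + k / 2 + (((d : ℤ) + l' : ℤ) : ℂ)) (k' - d),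
    ← two_mul_sub_one_mul_hermTwoGamma hs2]
  ring

/-! ## §3  The regular part is holomorphic on `{0 < re}` -/

/-- `s ↦ (Γ(s + c))⁻¹` is entire. [folklore] -/
theorem differentiable_inv_Gamma_add (c : ℂ) : Differentiable ℂ fun s : ℂ => (Complex.Gamma (s + c))⁻¹ :=
  Complex.differentiable_one_div_Gamma.comp (differentiable_id.add_const c)

/-- **`R_d` is holomorphic on `{0 < re s}`** (`1∕Γ` entire; `Γ(2s)` holomorphic there; `4^{−2s}`, polynomials entire). [folklore] -/
theorem differentiableOn_regularPart (k : ℤ) (k' : ℕ) (l' : ℤ) (d : ℕ) :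
    DifferentiableOn ℂ (fun s : ℂ => ((1 / 8 : ℂ) * (((4 * Real.pi ^ 4 : ℝ) : ℂ) * cexp ((Real.pi * I) * (k + 2 * (((d : ℤ) + l' : ℤ) : ℂ)))) *
          (((Real.pi : ℂ))⁻¹ * ((Complex.Gamma ((s + 1 - k / 2 - (((d : ℤ) + l' : ℤ) : ℂ)) + (d : ℂ)))⁻¹ * (Complex.Gamma ((s + 1 - k / 2 - (((d : ℤ) + l' : ℤ) : ℂ)) - 1))⁻¹)) *
          (((Real.pi : ℂ))⁻¹ * ((Complex.Gamma ((s + 1 + k / 2 + (((d : ℤ) + l' : ℤ) : ℂ)) + ((k' - d : ℕ) : ℂ)))⁻¹ * (Complex.Gamma ((s + 1 + k / 2 + (((d : ℤ) + l' : ℤ) : ℂ)) - 1))⁻¹)) *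
          ((Real.pi : ℂ) * Complex.Gamma (2 * s) ^ 2 * (4 : ℂ) ^ (-(2 * s))) *
          (∏ j ∈ Finset.range d, ((-s + 1 + (-(k : ℂ)) / 2) - (((d : ℤ) + l' - j : ℤ) : ℂ))) *
          (∏ j ∈ Finset.range (k' - d), ((-s + 1 - (-(k : ℂ)) / 2) + ((d + j : ℕ) : ℂ) + l')))) {s : ℂ | 0 < s.re} := by
  have hG : ∀ (c : ℂ) (f : ℂ → ℂ), (∀ s, f s = s + c) → Differentiable ℂ (fun s : ℂ => (Complex.Gamma (f s))⁻¹) := by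
    intro c f hf
    have e : (fun s : ℂ => (Complex.Gamma (f s))⁻¹) = fun s => (Complex.Gamma (s + c))⁻¹ := funext fun s => by rw [hf]
    rw [e]
    exact differentiable_inv_Gamma_add c
  have h1 := hG (1 - k / 2 - (((d : ℤ) + l' : ℤ) : ℂ) + d) (fun s => (s + 1 - k / 2 - (((d : ℤ) + l' : ℤ) : ℂ)) + (d : ℂ)) (fun s => by ring)
  have h2 := hG (1 - k / 2 - (((d : ℤ) + l' : ℤ) : ℂ) - 1) (fun s => (s + 1 - k / 2 - (((d : ℤ) + l' : ℤ) : ℂ)) - 1) (fun s => by ring)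
  have h3 := hG (1 + k / 2 + (((d : ℤ) + l' : ℤ) : ℂ) + ((k' - d : ℕ) : ℂ)) (fun s => (s + 1 + k / 2 + (((d : ℤ) + l' : ℤ) : ℂ)) + ((k' - d : ℕ) : ℂ)) (fun s => by ring)
  have h4 := hG (1 + k / 2 + (((d : ℤ) + l' : ℤ) : ℂ) - 1) (fun s => (s + 1 + k / 2 + (((d : ℤ) + l' : ℤ) : ℂ)) - 1) (fun s => by ring)
  have hΓ : DifferentiableOn ℂ (fun s : ℂ => Complex.Gamma (2 * s)) {s : ℂ | 0 < s.re} := fun s hs => by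
    have h2s : 0 < (2 * s).re := by
      simp only [Set.mem_setOf_eq] at hs
      simp only [mul_re, re_ofNat, im_ofNat, zero_mul, sub_zero]
      linarith
    exact ((Complex.differentiableAt_Gamma _ (ne_neg_nat_of_re_pos h2s)).comp s (by fun_prop)).differentiableWithinAt
  have hpow : Differentiable ℂ (fun s : ℂ => (4 : ℂ) ^ (-(2 * s))) := fun s =>
    DifferentiableAt.const_cpow (by fun_prop) (Or.inl (by norm_num))
  have hP1 : DifferentiableOn ℂ (fun s : ℂ => (∏ j ∈ Finset.range d, ((-s + 1 + (-(k : ℂ)) / 2) - (((d : ℤ) + l' - j : ℤ) : ℂ)))) {s : ℂ | 0 < s.re} :=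
    differentiableOn_finset_prod _ _ _ fun j _ => by fun_prop
  have hP2 : DifferentiableOn ℂ (fun s : ℂ => (∏ j ∈ Finset.range (k' - d), ((-s + 1 - (-(k : ℂ)) / 2) + ((d + j : ℕ) : ℂ) + l'))) {s : ℂ | 0 < s.re} :=
    differentiableOn_finset_prod _ _ _ fun j _ => by fun_prop
  exact (((((differentiableOn_const _).mul ((differentiableOn_const _).mul (h1.differentiableOn.mul h2.differentiableOn))).mul
    ((differentiableOn_const _).mul (h3.differentiableOn.mul h4.differentiableOn))).mul
    (((differentiableOn_const _).mul (hΓ.pow 2)).mul hpow.differentiableOn)).mul hP1).mul hP2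

/-! ## §4  Odd `k`: the regular part vanishes at `s = ½` -/

/-- **`R_d(½) = 0` for odd `k`** (`k = 2n+1`: `α(½)−1 = −(n+d+l′)` and `β(½)−1 = 1+n+d+l′` are integers with sum `1`, so one of `Γ(α−1)⁻¹`, `Γ(β−1)⁻¹` vanishes —
Mathlib `Gamma_neg_nat_eq_zero`).  I.e. the unnormalised `M_w(s)` is REGULAR at `½` on every `K_w`-type when `k` is odd. [Shimura1982, (1.31)] -/
theorem regularPart_half_eq_zero {k : ℤ} (hk : Odd k) (k' : ℕ) (l' : ℤ) (d : ℕ) :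
    (fun s : ℂ => ((1 / 8 : ℂ) * (((4 * Real.pi ^ 4 : ℝ) : ℂ) * cexp ((Real.pi * I) * (k + 2 * (((d : ℤ) + l' : ℤ) : ℂ)))) *
          (((Real.pi : ℂ))⁻¹ * ((Complex.Gamma ((s + 1 - k / 2 - (((d : ℤ) + l' : ℤ) : ℂ)) + (d : ℂ)))⁻¹ * (Complex.Gamma ((s + 1 - k / 2 - (((d : ℤ) + l' : ℤ) : ℂ)) - 1))⁻¹)) *
          (((Real.pi : ℂ))⁻¹ * ((Complex.Gamma ((s + 1 + k / 2 + (((d : ℤ) + l' : ℤ) : ℂ)) + ((k' - d : ℕ) : ℂ)))⁻¹ * (Complex.Gamma ((s + 1 + k / 2 + (((d : ℤ) + l' : ℤ) : ℂ)) - 1))⁻¹)) *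
          ((Real.pi : ℂ) * Complex.Gamma (2 * s) ^ 2 * (4 : ℂ) ^ (-(2 * s))) *
          (∏ j ∈ Finset.range d, ((-s + 1 + (-(k : ℂ)) / 2) - (((d : ℤ) + l' - j : ℤ) : ℂ))) *
          (∏ j ∈ Finset.range (k' - d), ((-s + 1 - (-(k : ℂ)) / 2) + ((d + j : ℕ) : ℂ) + l')))) (1 / 2) = 0 := by
  obtain ⟨n, rfl⟩ := hk
  beta_reduce
  rcases le_or_gt 0 (n + (d : ℤ) + l') with h | h
  · obtain ⟨t, ht⟩ := Int.eq_ofNat_of_zero_le h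
    have ht' : (n : ℂ) + (d : ℂ) + (l' : ℂ) = (t : ℂ) := by exact_mod_cast ht
    have hz : Complex.Gamma (((1 / 2 : ℂ) + 1 - ((2 * n + 1 : ℤ) : ℂ) / 2 - (((d : ℤ) + l' : ℤ) : ℂ)) - 1) = 0 := by
      rw [show ((1 / 2 : ℂ) + 1 - ((2 * n + 1 : ℤ) : ℂ) / 2 - (((d : ℤ) + l' : ℤ) : ℂ)) - 1 = -(t : ℂ) by push_cast; linear_combination (-1 : ℂ) * ht']
      exact Complex.Gamma_neg_nat_eq_zero t
    rw [hz, _root_.inv_zero]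
    ring
  · obtain ⟨t, ht⟩ : ∃ t : ℕ, n + (d : ℤ) + l' = -1 - t := ⟨(-1 - (n + (d : ℤ) + l')).toNat, by omega⟩
    have ht' : (n : ℂ) + (d : ℂ) + (l' : ℂ) = -1 - (t : ℂ) := by exact_mod_cast ht
    have hz : Complex.Gamma (((1 / 2 : ℂ) + 1 + ((2 * n + 1 : ℤ) : ℂ) / 2 + (((d : ℤ) + l' : ℤ) : ℂ)) - 1) = 0 := by
      rw [show ((1 / 2 : ℂ) + 1 + ((2 * n + 1 : ℤ) : ℂ) / 2 + (((d : ℤ) + l' : ℤ) : ℂ)) - 1 = -(t : ℂ) by push_cast; linear_combination ht']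
      exact Complex.Gamma_neg_nat_eq_zero t
    rw [hz, _root_.inv_zero]
    ring

/-! ## §5  The continued scalar of route `d`: `G_d := ½ · dslope R_d ½` -/

/-- `(2s − 1) · G_d(s) = R_d(s) − R_d(½)` for every `s` (Mathlib `sub_smul_dslope`). [folklore] -/
theorem continued_spec (k : ℤ) (k' : ℕ) (l' : ℤ) (d : ℕ) (s : ℂ) :
    (2 * s - 1) * ((2 : ℂ)⁻¹ * dslope (fun s : ℂ => ((1 / 8 : ℂ) * (((4 * Real.pi ^ 4 : ℝ) : ℂ) * cexp ((Real.pi * I) * (k + 2 * (((d : ℤ) + l' : ℤ) : ℂ)))) *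
          (((Real.pi : ℂ))⁻¹ * ((Complex.Gamma ((s + 1 - k / 2 - (((d : ℤ) + l' : ℤ) : ℂ)) + (d : ℂ)))⁻¹ * (Complex.Gamma ((s + 1 - k / 2 - (((d : ℤ) + l' : ℤ) : ℂ)) - 1))⁻¹)) *
          (((Real.pi : ℂ))⁻¹ * ((Complex.Gamma ((s + 1 + k / 2 + (((d : ℤ) + l' : ℤ) : ℂ)) + ((k' - d : ℕ) : ℂ)))⁻¹ * (Complex.Gamma ((s + 1 + k / 2 + (((d : ℤ) + l' : ℤ) : ℂ)) - 1))⁻¹)) *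
          ((Real.pi : ℂ) * Complex.Gamma (2 * s) ^ 2 * (4 : ℂ) ^ (-(2 * s))) *
          (∏ j ∈ Finset.range d, ((-s + 1 + (-(k : ℂ)) / 2) - (((d : ℤ) + l' - j : ℤ) : ℂ))) *
          (∏ j ∈ Finset.range (k' - d), ((-s + 1 - (-(k : ℂ)) / 2) + ((d + j : ℕ) : ℂ) + l')))) (1 / 2) s) =
      (fun s : ℂ => ((1 / 8 : ℂ) * (((4 * Real.pi ^ 4 : ℝ) : ℂ) * cexp ((Real.pi * I) * (k + 2 * (((d : ℤ) + l' : ℤ) : ℂ)))) *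
          (((Real.pi : ℂ))⁻¹ * ((Complex.Gamma ((s + 1 - k / 2 - (((d : ℤ) + l' : ℤ) : ℂ)) + (d : ℂ)))⁻¹ * (Complex.Gamma ((s + 1 - k / 2 - (((d : ℤ) + l' : ℤ) : ℂ)) - 1))⁻¹)) *
          (((Real.pi : ℂ))⁻¹ * ((Complex.Gamma ((s + 1 + k / 2 + (((d : ℤ) + l' : ℤ) : ℂ)) + ((k' - d : ℕ) : ℂ)))⁻¹ * (Complex.Gamma ((s + 1 + k / 2 + (((d : ℤ) + l' : ℤ) : ℂ)) - 1))⁻¹)) *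
          ((Real.pi : ℂ) * Complex.Gamma (2 * s) ^ 2 * (4 : ℂ) ^ (-(2 * s))) *
          (∏ j ∈ Finset.range d, ((-s + 1 + (-(k : ℂ)) / 2) - (((d : ℤ) + l' - j : ℤ) : ℂ))) *
          (∏ j ∈ Finset.range (k' - d), ((-s + 1 - (-(k : ℂ)) / 2) + ((d + j : ℕ) : ℂ) + l')))) s -
      (fun s : ℂ => ((1 / 8 : ℂ) * (((4 * Real.pi ^ 4 : ℝ) : ℂ) * cexp ((Real.pi * I) * (k + 2 * (((d : ℤ) + l' : ℤ) : ℂ)))) *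
          (((Real.pi : ℂ))⁻¹ * ((Complex.Gamma ((s + 1 - k / 2 - (((d : ℤ) + l' : ℤ) : ℂ)) + (d : ℂ)))⁻¹ * (Complex.Gamma ((s + 1 - k / 2 - (((d : ℤ) + l' : ℤ) : ℂ)) - 1))⁻¹)) *
          (((Real.pi : ℂ))⁻¹ * ((Complex.Gamma ((s + 1 + k / 2 + (((d : ℤ) + l' : ℤ) : ℂ)) + ((k' - d : ℕ) : ℂ)))⁻¹ * (Complex.Gamma ((s + 1 + k / 2 + (((d : ℤ) + l' : ℤ) : ℂ)) - 1))⁻¹)) *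
          ((Real.pi : ℂ) * Complex.Gamma (2 * s) ^ 2 * (4 : ℂ) ^ (-(2 * s))) *
          (∏ j ∈ Finset.range d, ((-s + 1 + (-(k : ℂ)) / 2) - (((d : ℤ) + l' - j : ℤ) : ℂ))) *
          (∏ j ∈ Finset.range (k' - d), ((-s + 1 - (-(k : ℂ)) / 2) + ((d + j : ℕ) : ℂ) + l')))) (1 / 2) := by
  have h := sub_smul_dslope (fun s : ℂ => ((1 / 8 : ℂ) * (((4 * Real.pi ^ 4 : ℝ) : ℂ) * cexp ((Real.pi * I) * (k + 2 * (((d : ℤ) + l' : ℤ) : ℂ)))) *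
          (((Real.pi : ℂ))⁻¹ * ((Complex.Gamma ((s + 1 - k / 2 - (((d : ℤ) + l' : ℤ) : ℂ)) + (d : ℂ)))⁻¹ * (Complex.Gamma ((s + 1 - k / 2 - (((d : ℤ) + l' : ℤ) : ℂ)) - 1))⁻¹)) *
          (((Real.pi : ℂ))⁻¹ * ((Complex.Gamma ((s + 1 + k / 2 + (((d : ℤ) + l' : ℤ) : ℂ)) + ((k' - d : ℕ) : ℂ)))⁻¹ * (Complex.Gamma ((s + 1 + k / 2 + (((d : ℤ) + l' : ℤ) : ℂ)) - 1))⁻¹)) *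
          ((Real.pi : ℂ) * Complex.Gamma (2 * s) ^ 2 * (4 : ℂ) ^ (-(2 * s))) *
          (∏ j ∈ Finset.range d, ((-s + 1 + (-(k : ℂ)) / 2) - (((d : ℤ) + l' - j : ℤ) : ℂ))) *
          (∏ j ∈ Finset.range (k' - d), ((-s + 1 - (-(k : ℂ)) / 2) + ((d + j : ℕ) : ℂ) + l')))) (1 / 2) s
  rw [smul_eq_mul] at h
  linear_combination h

/-- **`G_d` is holomorphic on `{0 < re s}`** (removable singularity: Mathlib `Complex.differentiableOn_dslope`). [folklore] -/
theorem differentiableOn_continued (k : ℤ) (k' : ℕ) (l' : ℤ) (d : ℕ) :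
    DifferentiableOn ℂ (fun s : ℂ => (2 : ℂ)⁻¹ * dslope (fun s : ℂ => ((1 / 8 : ℂ) * (((4 * Real.pi ^ 4 : ℝ) : ℂ) * cexp ((Real.pi * I) * (k + 2 * (((d : ℤ) + l' : ℤ) : ℂ)))) *
          (((Real.pi : ℂ))⁻¹ * ((Complex.Gamma ((s + 1 - k / 2 - (((d : ℤ) + l' : ℤ) : ℂ)) + (d : ℂ)))⁻¹ * (Complex.Gamma ((s + 1 - k / 2 - (((d : ℤ) + l' : ℤ) : ℂ)) - 1))⁻¹)) *
          (((Real.pi : ℂ))⁻¹ * ((Complex.Gamma ((s + 1 + k / 2 + (((d : ℤ) + l' : ℤ) : ℂ)) + ((k' - d : ℕ) : ℂ)))⁻¹ * (Complex.Gamma ((s + 1 + k / 2 + (((d : ℤ) + l' : ℤ) : ℂ)) - 1))⁻¹)) *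
          ((Real.pi : ℂ) * Complex.Gamma (2 * s) ^ 2 * (4 : ℂ) ^ (-(2 * s))) *
          (∏ j ∈ Finset.range d, ((-s + 1 + (-(k : ℂ)) / 2) - (((d : ℤ) + l' - j : ℤ) : ℂ))) *
          (∏ j ∈ Finset.range (k' - d), ((-s + 1 - (-(k : ℂ)) / 2) + ((d + j : ℕ) : ℂ) + l')))) (1 / 2) s) {s : ℂ | 0 < s.re} :=
  (differentiableOn_const _).mul ((Complex.differentiableOn_dslope
    ((isOpen_lt continuous_const Complex.continuous_re).mem_nhds (by norm_num : (0 : ℝ) < (1 / 2 : ℂ).re))).2 (differentiableOn_regularPart k k' l' d))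

/-! ## §6  Live routes compute `G_d(s)`; the routes agree -/

/-- `ev_1 f_{k′,l′} = 1`. [folklore] -/
theorem evalAt_one_fkl (k' : ℕ) (l' : ℤ) (h : (1 : Matrix (Fin 2) (Fin 2) ℂ).det ≠ 0) : evalAt 1 h (fkl uMat dz k' l') = 1 := by
  rw [fkl_apply, map_mul, map_pow, evalAt_uMat, evalAt_dz, Matrix.one_apply_eq, det_one, one_pow, _root_.one_zpow, one_mul]

/-- **A LIVE ROUTE COMPUTES `G_d(s)`** (odd `k`, `re s > ½`, `A_d(s) ≠ 0`): there is `F ∈ I_w(s,χ_k)` with `cp F = f_{k′,l′}`, `cp M_w F = G_d(s) • f_{k′,l′}`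
(★ FILE 7 `kType_pair_via` + §2 + §4 + §5: `B_d = G_d·A_d`, then ★ FILE 4 `scalar_of_pair`). [LeeZhu1998, §5 Prop. 5.4] -/
theorem route_scalar {k : ℤ} (hk : Odd k) (k' : ℕ) (l' : ℤ) (d : ℕ) (hd : d ≤ k') {s : ℂ} (hs : 1 / 2 < s.re)
    (hA : ((∏ j ∈ Finset.range d, ((s + 1 + (-(k : ℂ)) / 2) - (((d : ℤ) + l' - j : ℤ) : ℂ))) *
          (∏ j ∈ Finset.range (k' - d), ((s + 1 - (-(k : ℂ)) / 2) + ((d + j : ℕ) : ℂ) + l'))) ≠ 0) :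
    ∃ F : Matrix (Fin 2 ⊕ Fin 2) (Fin 2 ⊕ Fin 2) ℂ → ℂ, IsArchSiegelSection (fun z : ℂ => (conj z / ((‖z‖ : ℝ) : ℂ)) ^ k) s F ∧
      (∀ (v : Matrix (Fin 2) (Fin 2) ℂ), vᴴ * v = 1 → ∀ hv : v.det ≠ 0, F ((2 : ℂ)⁻¹ • fromBlocks (1 + v) (-(I • (1 - v))) (I • (1 - v)) (1 + v) : Matrix (Fin 2 ⊕ Fin 2) (Fin 2 ⊕ Fin 2) ℂ) = evalAt v hv (fkl uMat dz k' l')) ∧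
      (∀ (u : Matrix (Fin 2) (Fin 2) ℂ), uᴴ * u = 1 → ∀ hu' : u.det ≠ 0,
        archIntertwining F ((2 : ℂ)⁻¹ • fromBlocks (1 + u) (-(I • (1 - u))) (I • (1 - u)) (1 + u) : Matrix (Fin 2 ⊕ Fin 2) (Fin 2 ⊕ Fin 2) ℂ) = evalAt u hu' (((2 : ℂ)⁻¹ * dslope (fun s : ℂ => ((1 / 8 : ℂ) * (((4 * Real.pi ^ 4 : ℝ) : ℂ) * cexp ((Real.pi * I) * (k + 2 * (((d : ℤ) + l' : ℤ) : ℂ)))) *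
          (((Real.pi : ℂ))⁻¹ * ((Complex.Gamma ((s + 1 - k / 2 - (((d : ℤ) + l' : ℤ) : ℂ)) + (d : ℂ)))⁻¹ * (Complex.Gamma ((s + 1 - k / 2 - (((d : ℤ) + l' : ℤ) : ℂ)) - 1))⁻¹)) *
          (((Real.pi : ℂ))⁻¹ * ((Complex.Gamma ((s + 1 + k / 2 + (((d : ℤ) + l' : ℤ) : ℂ)) + ((k' - d : ℕ) : ℂ)))⁻¹ * (Complex.Gamma ((s + 1 + k / 2 + (((d : ℤ) + l' : ℤ) : ℂ)) - 1))⁻¹)) *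
          ((Real.pi : ℂ) * Complex.Gamma (2 * s) ^ 2 * (4 : ℂ) ^ (-(2 * s))) *
          (∏ j ∈ Finset.range d, ((-s + 1 + (-(k : ℂ)) / 2) - (((d : ℤ) + l' - j : ℤ) : ℂ))) *
          (∏ j ∈ Finset.range (k' - d), ((-s + 1 - (-(k : ℂ)) / 2) + ((d + j : ℕ) : ℂ) + l')))) (1 / 2) s) • (fkl uMat dz k' l'))) := by
  have hs2 : 2 * s - 1 ≠ 0 := by
    intro h0
    have := congrArg Complex.re h0
    simp only [sub_re, mul_re, re_ofNat, im_ofNat, zero_mul, sub_zero, one_re, zero_re] at this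
    linarith
  obtain ⟨F, hF, hFQ, hFM⟩ := kType_pair_via k hs k' l' d hd
  have hB : ((((1 / 8 : ℂ) * (((4 * Real.pi ^ 4 : ℝ) : ℂ) * cexp ((Real.pi * I) * (k + 2 * (((d : ℤ) + l' : ℤ) : ℂ))) * (hermTwoGamma (s + 1 - k / 2 - (((d : ℤ) + l' : ℤ) : ℂ)))⁻¹ *
            (hermTwoGamma (s + 1 + k / 2 + (((d : ℤ) + l' : ℤ) : ℂ)))⁻¹ * (hermTwoGamma (2 * s) * (4 : ℂ) ^ (-(2 * s))))) *
          (∏ j ∈ Finset.range d, ((-s + 1 + (-(k : ℂ)) / 2) - (((d : ℤ) + l' - j : ℤ) : ℂ)))) *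
          (∏ j ∈ Finset.range (k' - d), ((-s + 1 - (-(k : ℂ)) / 2) + ((d + j : ℕ) : ℂ) + l'))) =
      ((2 : ℂ)⁻¹ * dslope (fun s : ℂ => ((1 / 8 : ℂ) * (((4 * Real.pi ^ 4 : ℝ) : ℂ) * cexp ((Real.pi * I) * (k + 2 * (((d : ℤ) + l' : ℤ) : ℂ)))) *
          (((Real.pi : ℂ))⁻¹ * ((Complex.Gamma ((s + 1 - k / 2 - (((d : ℤ) + l' : ℤ) : ℂ)) + (d : ℂ)))⁻¹ * (Complex.Gamma ((s + 1 - k / 2 - (((d : ℤ) + l' : ℤ) : ℂ)) - 1))⁻¹)) *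
          (((Real.pi : ℂ))⁻¹ * ((Complex.Gamma ((s + 1 + k / 2 + (((d : ℤ) + l' : ℤ) : ℂ)) + ((k' - d : ℕ) : ℂ)))⁻¹ * (Complex.Gamma ((s + 1 + k / 2 + (((d : ℤ) + l' : ℤ) : ℂ)) - 1))⁻¹)) *
          ((Real.pi : ℂ) * Complex.Gamma (2 * s) ^ 2 * (4 : ℂ) ^ (-(2 * s))) *
          (∏ j ∈ Finset.range d, ((-s + 1 + (-(k : ℂ)) / 2) - (((d : ℤ) + l' - j : ℤ) : ℂ))) *
          (∏ j ∈ Finset.range (k' - d), ((-s + 1 - (-(k : ℂ)) / 2) + ((d + j : ℕ) : ℂ) + l')))) (1 / 2) s) *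
        ((∏ j ∈ Finset.range d, ((s + 1 + (-(k : ℂ)) / 2) - (((d : ℤ) + l' - j : ℤ) : ℂ))) *
          (∏ j ∈ Finset.range (k' - d), ((s + 1 - (-(k : ℂ)) / 2) + ((d + j : ℕ) : ℂ) + l'))) := by
    have hspec := continued_spec k k' l' d s
    rw [regularPart_half_eq_zero hk, sub_zero] at hspec
    apply mul_left_cancel₀ hs2
    conv_rhs => rw [← mul_assoc, hspec]
    exact regular_identity k k' l' d hs2
  obtain ⟨h0, h1, h2⟩ := scalar_of_pair k s hF (fkl uMat dz k' l') _ _ hA hFQ hFM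
  refine ⟨_, h0, h1, fun u hu hu' => ?_⟩
  rw [h2 u hu hu', hB, mul_div_cancel_right₀ _ hA]

/-- off the real axis every route is live: each factor of `A_d(s)` has imaginary part `im s`. [folklore] -/
theorem A_ne_zero_of_im_ne_zero (k : ℤ) (k' : ℕ) (l' : ℤ) (d : ℕ) {s : ℂ} (him : s.im ≠ 0) :
    ((∏ j ∈ Finset.range d, ((s + 1 + (-(k : ℂ)) / 2) - (((d : ℤ) + l' - j : ℤ) : ℂ))) *
          (∏ j ∈ Finset.range (k' - d), ((s + 1 - (-(k : ℂ)) / 2) + ((d + j : ℕ) : ℂ) + l'))) ≠ 0 := by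
  refine mul_ne_zero (Finset.prod_ne_zero_iff.2 fun j _ h0 => him ?_) (Finset.prod_ne_zero_iff.2 fun j _ h0 => him ?_)
  · have := congrArg Complex.im h0
    simpa using this
  · have := congrArg Complex.im h0
    simpa using this

/-- **TWO LIVE ROUTES AGREE**: `A_d(s) ≠ 0`, `A_{d′}(s) ≠ 0` ⇒ `G_d(s) = G_{d′}(s)` (both are THE scalar: ★ `eq_of_apply_kU_eq` + ★ FILE 7 `archIntertwining_congr_UJ`, read at `u = 1`).
[LeeZhu1998, §5 Prop. 5.4] -/
theorem route_eq {k : ℤ} (hk : Odd k) (k' : ℕ) (l' : ℤ) (d d' : ℕ) (hd : d ≤ k') (hd' : d' ≤ k') {s : ℂ} (hs : 1 / 2 < s.re)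
    (hA : ((∏ j ∈ Finset.range d, ((s + 1 + (-(k : ℂ)) / 2) - (((d : ℤ) + l' - j : ℤ) : ℂ))) *
          (∏ j ∈ Finset.range (k' - d), ((s + 1 - (-(k : ℂ)) / 2) + ((d + j : ℕ) : ℂ) + l'))) ≠ 0)
    (hA' : ((∏ j ∈ Finset.range d', ((s + 1 + (-(k : ℂ)) / 2) - (((d' : ℤ) + l' - j : ℤ) : ℂ))) *
          (∏ j ∈ Finset.range (k' - d'), ((s + 1 - (-(k : ℂ)) / 2) + ((d' + j : ℕ) : ℂ) + l'))) ≠ 0) :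
    ((2 : ℂ)⁻¹ * dslope (fun s : ℂ => ((1 / 8 : ℂ) * (((4 * Real.pi ^ 4 : ℝ) : ℂ) * cexp ((Real.pi * I) * (k + 2 * (((d : ℤ) + l' : ℤ) : ℂ)))) *
          (((Real.pi : ℂ))⁻¹ * ((Complex.Gamma ((s + 1 - k / 2 - (((d : ℤ) + l' : ℤ) : ℂ)) + (d : ℂ)))⁻¹ * (Complex.Gamma ((s + 1 - k / 2 - (((d : ℤ) + l' : ℤ) : ℂ)) - 1))⁻¹)) *
          (((Real.pi : ℂ))⁻¹ * ((Complex.Gamma ((s + 1 + k / 2 + (((d : ℤ) + l' : ℤ) : ℂ)) + ((k' - d : ℕ) : ℂ)))⁻¹ * (Complex.Gamma ((s + 1 + k / 2 + (((d : ℤ) + l' : ℤ) : ℂ)) - 1))⁻¹)) *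
          ((Real.pi : ℂ) * Complex.Gamma (2 * s) ^ 2 * (4 : ℂ) ^ (-(2 * s))) *
          (∏ j ∈ Finset.range d, ((-s + 1 + (-(k : ℂ)) / 2) - (((d : ℤ) + l' - j : ℤ) : ℂ))) *
          (∏ j ∈ Finset.range (k' - d), ((-s + 1 - (-(k : ℂ)) / 2) + ((d + j : ℕ) : ℂ) + l')))) (1 / 2) s) =
      ((2 : ℂ)⁻¹ * dslope (fun s : ℂ => ((1 / 8 : ℂ) * (((4 * Real.pi ^ 4 : ℝ) : ℂ) * cexp ((Real.pi * I) * (k + 2 * (((d' : ℤ) + l' : ℤ) : ℂ)))) *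
          (((Real.pi : ℂ))⁻¹ * ((Complex.Gamma ((s + 1 - k / 2 - (((d' : ℤ) + l' : ℤ) : ℂ)) + (d' : ℂ)))⁻¹ * (Complex.Gamma ((s + 1 - k / 2 - (((d' : ℤ) + l' : ℤ) : ℂ)) - 1))⁻¹)) *
          (((Real.pi : ℂ))⁻¹ * ((Complex.Gamma ((s + 1 + k / 2 + (((d' : ℤ) + l' : ℤ) : ℂ)) + ((k' - d' : ℕ) : ℂ)))⁻¹ * (Complex.Gamma ((s + 1 + k / 2 + (((d' : ℤ) + l' : ℤ) : ℂ)) - 1))⁻¹)) *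
          ((Real.pi : ℂ) * Complex.Gamma (2 * s) ^ 2 * (4 : ℂ) ^ (-(2 * s))) *
          (∏ j ∈ Finset.range d', ((-s + 1 + (-(k : ℂ)) / 2) - (((d' : ℤ) + l' - j : ℤ) : ℂ))) *
          (∏ j ∈ Finset.range (k' - d'), ((-s + 1 - (-(k : ℂ)) / 2) + ((d' + j : ℕ) : ℂ) + l')))) (1 / 2) s) := by
  obtain ⟨F, hF, hFQ, hFM⟩ := route_scalar hk k' l' d hd hs hA
  obtain ⟨F', hF', hF'Q, hF'M⟩ := route_scalar hk k' l' d' hd' hs hA'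
  have h1u : (1 : Matrix (Fin 2) (Fin 2) ℂ)ᴴ * 1 = 1 := by rw [conjTranspose_one, Matrix.mul_one]
  have h1d : (1 : Matrix (Fin 2) (Fin 2) ℂ).det ≠ 0 := by rw [det_one]; exact one_ne_zero
  have e := hFM 1 h1u h1d
  rw [archIntertwining_congr_UJ (fun g hg => eq_of_apply_kU_eq hF hF' (fun v hv => by
    rw [hFQ v hv (det_ne_zero_of_unitary hv), hF'Q v hv (det_ne_zero_of_unitary hv)]) hg) (kU_mem_UJ h1u), hF'M 1 h1u h1d,
    map_smul, map_smul, evalAt_one_fkl, smul_eq_mul, smul_eq_mul, mul_one, mul_one] at e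
  exact e.symm

/-- **THE ROUTES GLUE** (odd `k`): `G_d = G_{d′}` on all of `{0 < re s}` — identity theorem from the open set `{½ < re s, 0 < im s}` where both are live.
[folklore; Mathlib `AnalyticOnNhd.eqOn_of_preconnected_of_eventuallyEq`] -/
theorem route_glue {k : ℤ} (hk : Odd k) (k' : ℕ) (l' : ℤ) (d d' : ℕ) (hd : d ≤ k') (hd' : d' ≤ k') :
    Set.EqOn (fun s : ℂ => (2 : ℂ)⁻¹ * dslope (fun s : ℂ => ((1 / 8 : ℂ) * (((4 * Real.pi ^ 4 : ℝ) : ℂ) * cexp ((Real.pi * I) * (k + 2 * (((d : ℤ) + l' : ℤ) : ℂ)))) *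
          (((Real.pi : ℂ))⁻¹ * ((Complex.Gamma ((s + 1 - k / 2 - (((d : ℤ) + l' : ℤ) : ℂ)) + (d : ℂ)))⁻¹ * (Complex.Gamma ((s + 1 - k / 2 - (((d : ℤ) + l' : ℤ) : ℂ)) - 1))⁻¹)) *
          (((Real.pi : ℂ))⁻¹ * ((Complex.Gamma ((s + 1 + k / 2 + (((d : ℤ) + l' : ℤ) : ℂ)) + ((k' - d : ℕ) : ℂ)))⁻¹ * (Complex.Gamma ((s + 1 + k / 2 + (((d : ℤ) + l' : ℤ) : ℂ)) - 1))⁻¹)) *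
          ((Real.pi : ℂ) * Complex.Gamma (2 * s) ^ 2 * (4 : ℂ) ^ (-(2 * s))) *
          (∏ j ∈ Finset.range d, ((-s + 1 + (-(k : ℂ)) / 2) - (((d : ℤ) + l' - j : ℤ) : ℂ))) *
          (∏ j ∈ Finset.range (k' - d), ((-s + 1 - (-(k : ℂ)) / 2) + ((d + j : ℕ) : ℂ) + l')))) (1 / 2) s)
      (fun s : ℂ => (2 : ℂ)⁻¹ * dslope (fun s : ℂ => ((1 / 8 : ℂ) * (((4 * Real.pi ^ 4 : ℝ) : ℂ) * cexp ((Real.pi * I) * (k + 2 * (((d' : ℤ) + l' : ℤ) : ℂ)))) *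
          (((Real.pi : ℂ))⁻¹ * ((Complex.Gamma ((s + 1 - k / 2 - (((d' : ℤ) + l' : ℤ) : ℂ)) + (d' : ℂ)))⁻¹ * (Complex.Gamma ((s + 1 - k / 2 - (((d' : ℤ) + l' : ℤ) : ℂ)) - 1))⁻¹)) *
          (((Real.pi : ℂ))⁻¹ * ((Complex.Gamma ((s + 1 + k / 2 + (((d' : ℤ) + l' : ℤ) : ℂ)) + ((k' - d' : ℕ) : ℂ)))⁻¹ * (Complex.Gamma ((s + 1 + k / 2 + (((d' : ℤ) + l' : ℤ) : ℂ)) - 1))⁻¹)) *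
          ((Real.pi : ℂ) * Complex.Gamma (2 * s) ^ 2 * (4 : ℂ) ^ (-(2 * s))) *
          (∏ j ∈ Finset.range d', ((-s + 1 + (-(k : ℂ)) / 2) - (((d' : ℤ) + l' - j : ℤ) : ℂ))) *
          (∏ j ∈ Finset.range (k' - d'), ((-s + 1 - (-(k : ℂ)) / 2) + ((d' + j : ℕ) : ℂ) + l')))) (1 / 2) s) {s : ℂ | 0 < s.re} := by
  have hU : IsOpen {s : ℂ | 0 < s.re} := isOpen_lt continuous_const Complex.continuous_re
  have hV : IsOpen {s : ℂ | 1 / 2 < s.re ∧ 0 < s.im} :=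
    (isOpen_lt continuous_const Complex.continuous_re).inter (isOpen_lt continuous_const Complex.continuous_im)
  have h0 : (1 + I : ℂ) ∈ {s : ℂ | 0 < s.re} := by simp
  have hV0 : (1 + I : ℂ) ∈ {s : ℂ | 1 / 2 < s.re ∧ 0 < s.im} := by
    simp only [Set.mem_setOf_eq, add_re, one_re, I_re, add_zero, add_im, one_im, I_im, zero_add]
    norm_num
  refine ((differentiableOn_continued k k' l' d).analyticOnNhd hU).eqOn_of_preconnected_of_eventuallyEq
    ((differentiableOn_continued k k' l' d').analyticOnNhd hU) ((convex_halfSpace_re_gt (0 : ℝ)).isPreconnected) h0 ?_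
  filter_upwards [hV.mem_nhds hV0] with s hs
  exact route_eq hk k' l' d d' hd hd' hs.1 (A_ne_zero_of_im_ne_zero k k' l' d hs.2.ne') (A_ne_zero_of_im_ne_zero k k' l' d' hs.2.ne')

/-! ## §7  The theorem -/

/-- **(E8) PER `K_w`-TYPE, SINGLE COMPLEX PLACE: THE SCALAR OF `M_w(s)` ON `W_{(k′,l′)} ⊂ I_w(s,χ_k)` IS HOLOMORPHIC ON `{0 < re s}` FOR ODD `k`.**
There is `G : ℂ → ℂ`, holomorphic on `{0 < re s}`, with (a) `G(s)·A_d(s) = B_d(s)` for every route `d ≤ k′` and every `s` with `re s > ½` (so `G = B_d∕A_d` = the product of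
the anchor scalar `c_{k,d+l′}(s)` and the arrow ratios wherever the route is live — BY VALUE), and (b) at every `s` with `re s > ½`, for every `Q ∈ W_{(k′,l′)}`: some
`F ∈ I_w(s,χ_k)` has `cp F = Q`, `cp M_w(s) F = G(s) • Q`, and EVERY `F ∈ I_w(s,χ_k)` with `cp F = Q` has `M_w(s) F (k_u) = ev_u (G(s) • Q)` for all unitary `u`.
[Shimura1982, (1.31)] [LeeZhu1998, §5 Prop. 5.4] [KudlaRallis1994, §1] [Tan1999, §3] -/
theorem kType_scalar_continuation {k : ℤ} (hk : Odd k) (k' : ℕ) (l' : ℤ) :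
    ∃ G : ℂ → ℂ, DifferentiableOn ℂ G {s : ℂ | 0 < s.re} ∧
      (∀ d : ℕ, d ≤ k' → ∀ s : ℂ, 1 / 2 < s.re →
        G s * ((∏ j ∈ Finset.range d, ((s + 1 + (-(k : ℂ)) / 2) - (((d : ℤ) + l' - j : ℤ) : ℂ))) *
          (∏ j ∈ Finset.range (k' - d), ((s + 1 - (-(k : ℂ)) / 2) + ((d + j : ℕ) : ℂ) + l'))) =
          ((((1 / 8 : ℂ) * (((4 * Real.pi ^ 4 : ℝ) : ℂ) * cexp ((Real.pi * I) * (k + 2 * (((d : ℤ) + l' : ℤ) : ℂ))) * (hermTwoGamma (s + 1 - k / 2 - (((d : ℤ) + l' : ℤ) : ℂ)))⁻¹ *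
            (hermTwoGamma (s + 1 + k / 2 + (((d : ℤ) + l' : ℤ) : ℂ)))⁻¹ * (hermTwoGamma (2 * s) * (4 : ℂ) ^ (-(2 * s))))) *
          (∏ j ∈ Finset.range d, ((-s + 1 + (-(k : ℂ)) / 2) - (((d : ℤ) + l' - j : ℤ) : ℂ)))) *
          (∏ j ∈ Finset.range (k' - d), ((-s + 1 - (-(k : ℂ)) / 2) + ((d + j : ℕ) : ℂ) + l')))) ∧
      (∀ s : ℂ, 1 / 2 < s.re → ∀ Q : Carrier, Q ∈ kType k' l' →
        (∃ F : Matrix (Fin 2 ⊕ Fin 2) (Fin 2 ⊕ Fin 2) ℂ → ℂ, IsArchSiegelSection (fun z : ℂ => (conj z / ((‖z‖ : ℝ) : ℂ)) ^ k) s F ∧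
          (∀ (v : Matrix (Fin 2) (Fin 2) ℂ), vᴴ * v = 1 → ∀ hv : v.det ≠ 0, F ((2 : ℂ)⁻¹ • fromBlocks (1 + v) (-(I • (1 - v))) (I • (1 - v)) (1 + v) : Matrix (Fin 2 ⊕ Fin 2) (Fin 2 ⊕ Fin 2) ℂ) = evalAt v hv Q) ∧
          (∀ (u : Matrix (Fin 2) (Fin 2) ℂ), uᴴ * u = 1 → ∀ hu' : u.det ≠ 0,
        archIntertwining F ((2 : ℂ)⁻¹ • fromBlocks (1 + u) (-(I • (1 - u))) (I • (1 - u)) (1 + u) : Matrix (Fin 2 ⊕ Fin 2) (Fin 2 ⊕ Fin 2) ℂ) = evalAt u hu' (G s • Q))) ∧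
        (∀ F : Matrix (Fin 2 ⊕ Fin 2) (Fin 2 ⊕ Fin 2) ℂ → ℂ, IsArchSiegelSection (fun z : ℂ => (conj z / ((‖z‖ : ℝ) : ℂ)) ^ k) s F →
          (∀ (v : Matrix (Fin 2) (Fin 2) ℂ), vᴴ * v = 1 → ∀ hv : v.det ≠ 0, F ((2 : ℂ)⁻¹ • fromBlocks (1 + v) (-(I • (1 - v))) (I • (1 - v)) (1 + v) : Matrix (Fin 2 ⊕ Fin 2) (Fin 2 ⊕ Fin 2) ℂ) = evalAt v hv Q) →
          ∀ (u : Matrix (Fin 2) (Fin 2) ℂ), uᴴ * u = 1 → ∀ hu' : u.det ≠ 0,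
        archIntertwining F ((2 : ℂ)⁻¹ • fromBlocks (1 + u) (-(I • (1 - u))) (I • (1 - u)) (1 + u) : Matrix (Fin 2 ⊕ Fin 2) (Fin 2 ⊕ Fin 2) ℂ) = evalAt u hu' (G s • Q))) := by
  refine ⟨_, differentiableOn_continued k k' l' 0, fun d hd s hs => ?_, fun s hs Q hQ => ?_⟩
  · have hs0 : s ∈ {s : ℂ | 0 < s.re} := by simp only [Set.mem_setOf_eq]; linarith
    have hs2 : 2 * s - 1 ≠ 0 := by
      intro h0
      have := congrArg Complex.re h0
      simp only [sub_re, mul_re, re_ofNat, im_ofNat, zero_mul, sub_zero, one_re, zero_re] at this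
      linarith
    have e := route_glue hk k' l' 0 d (Nat.zero_le _) hd hs0
    beta_reduce at e ⊢
    rw [e]
    apply mul_left_cancel₀ hs2
    rw [← mul_assoc, continued_spec, regularPart_half_eq_zero hk, sub_zero, regular_identity k k' l' d hs2]
  · have hs0 : s ∈ {s : ℂ | 0 < s.re} := by simp only [Set.mem_setOf_eq]; linarith
    obtain ⟨d, hd, hA⟩ := exists_route_live k k' l' hs
    obtain ⟨F, hF, hFQ, hFM⟩ := route_scalar hk k' l' d hd hs hA
    have e := route_glue hk k' l' 0 d (Nat.zero_le _) hd hs0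
    beta_reduce at e ⊢
    rw [e]
    obtain ⟨c, hc⟩ := kType_scalar_at k hs k' l'
    have h1u : (1 : Matrix (Fin 2) (Fin 2) ℂ)ᴴ * 1 = 1 := by rw [conjTranspose_one, Matrix.mul_one]
    have h1d : (1 : Matrix (Fin 2) (Fin 2) ℂ).det ≠ 0 := by rw [det_one]; exact one_ne_zero
    have hcG : c = ((2 : ℂ)⁻¹ * dslope (fun s : ℂ => ((1 / 8 : ℂ) * (((4 * Real.pi ^ 4 : ℝ) : ℂ) * cexp ((Real.pi * I) * (k + 2 * (((d : ℤ) + l' : ℤ) : ℂ)))) *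
          (((Real.pi : ℂ))⁻¹ * ((Complex.Gamma ((s + 1 - k / 2 - (((d : ℤ) + l' : ℤ) : ℂ)) + (d : ℂ)))⁻¹ * (Complex.Gamma ((s + 1 - k / 2 - (((d : ℤ) + l' : ℤ) : ℂ)) - 1))⁻¹)) *
          (((Real.pi : ℂ))⁻¹ * ((Complex.Gamma ((s + 1 + k / 2 + (((d : ℤ) + l' : ℤ) : ℂ)) + ((k' - d : ℕ) : ℂ)))⁻¹ * (Complex.Gamma ((s + 1 + k / 2 + (((d : ℤ) + l' : ℤ) : ℂ)) - 1))⁻¹)) *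
          ((Real.pi : ℂ) * Complex.Gamma (2 * s) ^ 2 * (4 : ℂ) ^ (-(2 * s))) *
          (∏ j ∈ Finset.range d, ((-s + 1 + (-(k : ℂ)) / 2) - (((d : ℤ) + l' - j : ℤ) : ℂ))) *
          (∏ j ∈ Finset.range (k' - d), ((-s + 1 - (-(k : ℂ)) / 2) + ((d + j : ℕ) : ℂ) + l')))) (1 / 2) s) := by
      have e1 := (hc _ (fkl_mem_kType k' l')).2 F hF hFQ 1 h1u h1d
      rw [hFM 1 h1u h1d, map_smul, map_smul, evalAt_one_fkl, smul_eq_mul, smul_eq_mul, mul_one, mul_one] at e1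
      exact e1.symm
    rw [← hcG]
    exact hc Q hQ

end Summit.HodgeConjecture.HodgeConjecture.Cruxes.HLiu418.K2LiuArchKTypeScalarContinuation

end
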